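import Literature.AnabelianGeometry.SemiGraphs.TemperedReconstructionAssemblyThm37
import Literature.AnabelianGeometry.SemiGraphs.TemperedReconstructionReductionsProofsAt
import Literature.AnabelianGeometry.SemiGraphs.TemperedReconstructionBaseUniquenessProofs
import Literature.AnabelianGeometry.SemiGraphs.TemperedThm37OfCompactInVerticialAt
import HarnessLib

/-!
# The literal Corollary 3.9 from Thm. 3.7 (i), (iii), R2 and R3 — AT ONE PAIR OF GRAPHS (φ2 twin)

Mochizuki, *Semi-graphs of anabelioids*, Publ. RIMS **42** (2006), §3, Cor. 3.9, proof pp. 42–43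
[cite: MochizukiSemiAnbd2006, Cor 3.9 pp.42-43].

Companion of `TemperedReconstructionAssemblyThm37.lean` (abc-iut-L3-t2) under the cell's φ2-consumers
programme (rulings φ2 / α4-3 / α5-3 of abc-iut-L3-lead): `corollary_3_9_of_thm37_i_iii` is re-proved
AT ONE PAIR `(𝒢, ℋ)` with charts `(c𝒢, cℋ)`, with the per-graph hypotheses
`(h𝒢iii : CompactInVerticialAt 𝒢)`, `(hℋiii : CompactInVerticialAt ℋ)` (abc-iut-w4-d075) in place of the
∀-countable named fact `CompactInVerticial`.  The literal `Cor39` has no per-pair name, so the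
conclusion is its BODY at the pair, spelled out; the step hypotheses R2 (`QuasiGeometricGraphData`,
literal reading) and R3 (`InducesOfCompatible`, chosen conjugators) are likewise taken AT THE PAIR
(`hR2`, `hR3`, inline) — both remain the honest open inputs of the literal reading (cell findings
t2g2-F1 / d080-F2; the up-to-twist compatible reading is closed modulo (iii) in
`TemperedReconstructionCor39UpToTwistAssembly[At]`).  (iii) enters only through Thm. 3.7 (iv) at
both graphs (R0, abc-iut-L3-d1's `InducedIsQuasiGeometric_of_at`); R1 is `InducesCompatible_holds`,
R4 is abc-iut-w4-d083's UNCONDITIONAL `compatibleEdgeMapUnique_holds`, so no `EdgeLikeDistinct` input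
remains.  Proof-only; the original file is untouched.  Nothing here takes a side on [IUTchIII]
Cor. 3.12; typed ≠ discharged.
-/

namespace Literature.AnabelianGeometry.SemiGraphs

namespace ProfiniteSemiGraph

universe u

variable {𝒢 ℋ : ProfiniteSemiGraph.{u}}

/-- **The literal Cor. 3.9 at the pair `(G, H)` from its steps at the pair** (per-pair form of
`corollary_3_9_of_steps`): (a) = R1 ≫ R0 (Thm. 3.7 (iv) AT `𝒢` and AT `ℋ`); (b)-existence = R2 ≫ R3
(per-pair inputs); (b)-uniqueness = R1 ×2 + `compatible_vertexMap_eq` + R4 (unconditional).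
[cite: MochizukiSemiAnbd2006, Cor 3.9 pp.42-43] -/
theorem corollary_3_9_of_stepsAt (h37i : VerticialInjective.{u})
    (h37iv𝒢 : MaximalCompactIffVerticialAt 𝒢) (h37ivℋ : MaximalCompactIffVerticialAt ℋ)
    (h𝒢 : Cor39Hypotheses 𝒢) (hℋ : Cor39Hypotheses ℋ) (c𝒢 : TemperedPiChart 𝒢) (cℋ : TemperedPiChart ℋ)
    (hR2 : ∀ φ : c𝒢.G →ₜ* cℋ.G, IsQuasiGeometric φ →
      ∃ F : Hom 𝒢 ℋ, F.IsLocallyOpen ∧ F.CompatV c𝒢 cℋ φ ∧ F.CompatE c𝒢 cℋ φ)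
    (hR3 : ∀ (F : Hom 𝒢 ℋ) (φ : c𝒢.G →ₜ* cℋ.G), F.IsLocallyOpen → F.CompatV c𝒢 cℋ φ →
      F.CompatE c𝒢 cℋ φ → F.Induces c𝒢 cℋ φ) :
    (∀ (F : Hom 𝒢 ℋ), F.IsLocallyOpen → ∀ φ : c𝒢.G →ₜ* cℋ.G, F.Induces c𝒢 cℋ φ →
        IsQuasiGeometric φ) ∧
      ∀ φ : c𝒢.G →ₜ* cℋ.G, IsQuasiGeometric φ →
        ∃ F : Hom 𝒢 ℋ, F.IsLocallyOpen ∧ F.Induces c𝒢 cℋ φ ∧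
          ∀ F' : Hom 𝒢 ℋ, F'.IsLocallyOpen → F'.Induces c𝒢 cℋ φ →
            F'.base.vertexMap = F.base.vertexMap ∧ F'.base.edgeMap = F.base.edgeMap := by
  refine ⟨fun F hF φ hind => ?_, fun φ hφ => ?_⟩
  · obtain ⟨hV, hE⟩ := InducesCompatible_holds 𝒢 ℋ h𝒢 hℋ c𝒢 cℋ F φ hind
    exact InducedIsQuasiGeometric_of_at h37i h37iv𝒢 h37ivℋ h𝒢 hℋ c𝒢 cℋ F φ hF hV hE
  · obtain ⟨F, hF, hV, hE⟩ := hR2 φ hφ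
    refine ⟨F, hF, hR3 F φ hF hV hE, fun F' hF' hind' => ?_⟩
    obtain ⟨hV', hE'⟩ := InducesCompatible_holds 𝒢 ℋ h𝒢 hℋ c𝒢 cℋ F' φ hind'
    have hv : F'.base.vertexMap = F.base.vertexMap :=
      compatible_vertexMap_eq h37i verticialDistinct_holds h𝒢 hℋ c𝒢 cℋ hF' hV' hV
    exact ⟨hv, compatibleEdgeMapUnique_holds 𝒢 ℋ h𝒢 hℋ c𝒢 cℋ F' F φ hF' hF hV' hE' hV hE hv⟩

/-- **[SemiAnbd] Cor. 3.9 (literal reading) at the pair `(G, H)` from Thm. 3.7 (i), (iii) AT `𝒢`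
AND AT `ℋ`, the graph-data step R2 and the temperoid-level step R3 at the pair** — per-pair form of
`corollary_3_9_of_thm37_i_iii`. [cite: MochizukiSemiAnbd2006, Cor 3.9 pp.42-43] -/
theorem corollary_3_9_of_thm37_i_iiiAt (h37i : VerticialInjective.{u})
    (h𝒢iii : CompactInVerticialAt 𝒢) (hℋiii : CompactInVerticialAt ℋ) (h𝒢 : Cor39Hypotheses 𝒢)
    (hℋ : Cor39Hypotheses ℋ) (c𝒢 : TemperedPiChart 𝒢) (cℋ : TemperedPiChart ℋ)
    (hR2 : ∀ φ : c𝒢.G →ₜ* cℋ.G, IsQuasiGeometric φ →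
      ∃ F : Hom 𝒢 ℋ, F.IsLocallyOpen ∧ F.CompatV c𝒢 cℋ φ ∧ F.CompatE c𝒢 cℋ φ)
    (hR3 : ∀ (F : Hom 𝒢 ℋ) (φ : c𝒢.G →ₜ* cℋ.G), F.IsLocallyOpen → F.CompatV c𝒢 cℋ φ →
      F.CompatE c𝒢 cℋ φ → F.Induces c𝒢 cℋ φ) :
    (∀ (F : Hom 𝒢 ℋ), F.IsLocallyOpen → ∀ φ : c𝒢.G →ₜ* cℋ.G, F.Induces c𝒢 cℋ φ →
        IsQuasiGeometric φ) ∧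
      ∀ φ : c𝒢.G →ₜ* cℋ.G, IsQuasiGeometric φ →
        ∃ F : Hom 𝒢 ℋ, F.IsLocallyOpen ∧ F.Induces c𝒢 cℋ φ ∧
          ∀ F' : Hom 𝒢 ℋ, F'.IsLocallyOpen → F'.Induces c𝒢 cℋ φ →
            F'.base.vertexMap = F.base.vertexMap ∧ F'.base.edgeMap = F.base.edgeMap :=
  corollary_3_9_of_stepsAt h37i (maximalCompactIffVerticialAt_of_compactInVerticialAt h𝒢iii)
    (maximalCompactIffVerticialAt_of_compactInVerticialAt hℋiii) h𝒢 hℋ c𝒢 cℋ hR2 hR3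

/-- The ∀-countable original specialises to the per-pair form: the frozen `Cor39` follows from
Thm. 3.7 (i), `CompactInVerticialAt` at every graph, R2 and R3 (sanity link to
`corollary_3_9_of_thm37_i_iii`). [cite: MochizukiSemiAnbd2006, Cor 3.9 pp.42-43] -/
theorem corollary_3_9_of_forall_compactInVerticialAt (h37i : VerticialInjective.{u})
    (hiii : ∀ 𝒢 : ProfiniteSemiGraph.{u}, CompactInVerticialAt 𝒢) (hR2 : QuasiGeometricGraphData.{u})
    (hR3 : InducesOfCompatible.{u}) : Cor39.{u} :=
  fun 𝒢 ℋ h𝒢 hℋ c𝒢 cℋ =>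
    corollary_3_9_of_thm37_i_iiiAt h37i (hiii 𝒢) (hiii ℋ) h𝒢 hℋ c𝒢 cℋ (hR2 𝒢 ℋ h𝒢 hℋ c𝒢 cℋ)
      (hR3 𝒢 ℋ h𝒢 hℋ c𝒢 cℋ)

end ProfiniteSemiGraph

end Literature.AnabelianGeometry.SemiGraphs
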